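import Summits.ResolutionOfSingularities.ResolutionOfSingularities.Theorems.WeightedInvariantIotaUpperSemicontinuousLE
import Summits.ResolutionOfSingularities.ResolutionOfSingularities.Theorems.WeightedInvariantTieFinitePrimesOver
import Summits.ResolutionOfSingularities.ResolutionOfSingularities.Theorems.WeightedInvariantTieFiniteChartDict
import Summits.ResolutionOfSingularities.ResolutionOfSingularities.Theorems.WeightedInvariantIota3Tau
import HarnessLib

/-!
# (c8)≤3 FOR THE STRATIFIER `ι₀ = (ν ; ε ; τ) = Iota3.iotaOrdEpsTau` — UNCONDITIONAL: the tie points of a smooth quasi-compact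
# threefold are finitely many (door `HypersurfaceCentreConstruction`, stmt-ResolutionOfSingularities-19897; P3 rung
# `stub_keyRungGrHomLE_three`, gap hc8 `IotaUpperSemicontinuousLE 3 p Iota3.iotaFlatT`)

Topic: `Summits/ResolutionOfSingularities/ResolutionOfSingularities/Theorems`. Helper for the door item `HypersurfaceCentreConstruction`
(stmt-ResolutionOfSingularities-19897, route `WeightedInvariant`), line `local-engine`, def-free.  The scheme corollary that res-type-047's
D2 spec left unassembled: the KEY finiteness `TieFinite.finite_tiePrimes_over` ((Δ10-d), …TieFinitePrimesOver) read in an affine chart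
through a maximal point `η` of `{n ≤ ν}` supplies the per-curve binder of `TieFinite.tiePoints_finite_of_curveFinite'` (…TieFiniteCurveClosed),
so on a smooth quasi-compact `Y` over a perfect field all of whose local rings have Krull dimension `≤ 3` the set of tie points
`{z | IsTiePosition 𝒪_{Y,z} f_z}` of every `f ∈ Γ(Y, 𝒪_Y)` is FINITE (`TieFinite.tiePoints_finite`).  Consequences:

* `TieFinite.finite_tiePrimes_over_of_maximal` — ring level: over a prime `𝔭` of a finite-type algebra `A` over a perfect field at which
  `ord F = n` and below which the order drops, the tie primes `𝔮 ⊇ 𝔭` of order `n` are finitely many (their `(ν ; ε)`-stratum prime is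
  `𝔭 A_𝔮` by `TieFinite.IsTiePosition.topStratumPrime_eq_of_maximal`);
* `Iota3.iotaTau_upperSemicontinuousOnLE_three` — (c8τ)≤3: `IotaUpperSemicontinuousOnLE 3 p iotaOrdEps iotaTau`
  (`GenerizationClosed.indicator_upperSemicontinuousOnLE` on the finiteness);
* **`Iota3.iotaOrdEpsTau_upperSemicontinuousLE_three`** — (c8)≤3 FOR THE STRATIFIER: `IotaUpperSemicontinuousLE 3 p Iota3.iotaOrdEpsTau`,
  every `p` (`iotaLex_upperSemicontinuousLE` over `iotaOrdEps_upperSemicontinuousLE`);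
* `Iota3.iotaFlatT_upperSemicontinuousLE_three_of_cylinder` — the gap hc8 of `keyRungGrHomLE_three_of_residue_at_powers` for the invariant of
  record `ι₃ᵗ = iotaFlatT` REDUCED to the stratum-relative clause for the generically-read `σ` alone:
  `IotaUpperSemicontinuousOnLE 3 p iotaOrdEpsTau (iotaCylinder iotaOrdEpsTau iotaSigma) → IotaUpperSemicontinuousLE 3 p iotaFlatT`.

[OURS · L1 W4.3 · (c8τ)≤3 / (c8)≤3 for ι₀]  Replaces the role of NO printed item; NOT a statement of the manuscript under review
[claim: Hironaka2017, status: under-review]; candidates stay candidates; AI work, weaker than expert review; no claim about resolution of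
singularities in characteristic `p` beyond the typed statements.  No definition; no axiom; no named fact taken as hypothesis.

## References

* D. Abramovich, M. H. Quek, B. Schober, arXiv:2507.01232 (2025), Thm 1.3 (3), Thm 3.5 (the weighted centre germs behind
  `finite_tiePrimes_over`). [AbramovichQuekSchober2025]
* A. Grothendieck, EGA I 1.3 (stalks of affine schemes are localisations). [folklore]
-/

noncomputable section

set_option linter.dupNamespace false -- mandated namespace `Summit.<Summit>.<Problem>` of this single-conjunct summit

open CategoryTheory AlgebraicGeometry TopologicalSpace IsLocalRing Topology
open Literature.AlgebraicGeometry.Resolution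
open Summit.ResolutionOfSingularities.ResolutionOfSingularities.Theorems
open Summit.ResolutionOfSingularities.ResolutionOfSingularities.Theorems.ContactCylinder

namespace Summit.ResolutionOfSingularities.ResolutionOfSingularities.Cruxes.HypersurfaceCentreConstruction.LocalEngine

namespace TieFinite

open Iota3

/-! ## §1 Ring level: finitely many tie primes of order `n` over a maximal prime of order `n` -/

/-- Equal primes have localisations of the same Krull dimension. [folklore] -/
theorem ringKrullDim_atPrime_congr {A : Type} [CommRing A] {I I' : Ideal A} (h : I = I') [I.IsPrime] [I'.IsPrime] :
    ringKrullDim (Localization.AtPrime I) = ringKrullDim (Localization.AtPrime I') := by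
  subst h
  rfl

/-- **At a tie prime `𝔮 ⊇ 𝔭` of the same order as `𝔭`, with the order dropping strictly below `𝔭`, the `(ν ; ε)`-top-stratum prime of
`(A_𝔮, F)` is `𝔭 A_𝔮`** (`TieFinite.IsTiePosition.topStratumPrime_eq_of_maximal` read through `(A_𝔮)_{Q} ≃ A_{Q ∩ A}`). [OURS] -/
theorem topStratumPrime_eq_map_of_maximal {A : Type} [CommRing A] (F : A) (𝔭 : Ideal A) [𝔭.IsPrime] (n : ℕ)
    (hν𝔭 : iotaOrd (Localization.AtPrime 𝔭) (algebraMap A (Localization.AtPrime 𝔭) F) = n)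
    (hmax : ∀ (𝔮' : Ideal A) [𝔮'.IsPrime], 𝔮' < 𝔭 →
      iotaOrd (Localization.AtPrime 𝔮') (algebraMap A (Localization.AtPrime 𝔮') F) < n)
    (𝔮 : Ideal A) [𝔮.IsPrime] (hle : 𝔭 ≤ 𝔮)
    (htie : IsTiePosition (Localization.AtPrime 𝔮) (algebraMap A (Localization.AtPrime 𝔮) F))
    (hν𝔮 : iotaOrd (Localization.AtPrime 𝔮) (algebraMap A (Localization.AtPrime 𝔮) F) = n) :
    topStratumPrime iotaOrdEps (Localization.AtPrime 𝔮) (algebraMap A (Localization.AtPrime 𝔮) F) =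
      𝔭.map (algebraMap A (Localization.AtPrime 𝔮)) := by
  haveI := isPrime_map_atPrime_of_le 𝔭 𝔮 hle
  refine IsTiePosition.topStratumPrime_eq_of_maximal htie (𝔭.map (algebraMap A (Localization.AtPrime 𝔮))) ?_ ?_
  · rw [hν𝔮, StratumIff.iota_localization_localization_eq iotaOrd iotaOrd_isoInvariant 𝔮 _ F,
      StratumIff.iota_localization_congr iotaOrd (comap_map_atPrime_of_le 𝔭 𝔮 hle) F, hν𝔭]
  · intro Q _ hQ
    rw [hν𝔮, StratumIff.iota_localization_localization_eq iotaOrd iotaOrd_isoInvariant 𝔮 _ F]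
    refine hmax (Q.comap (algebraMap A (Localization.AtPrime 𝔮))) (lt_of_le_of_ne ?_ ?_)
    · calc Q.comap (algebraMap A (Localization.AtPrime 𝔮))
          ≤ (𝔭.map (algebraMap A (Localization.AtPrime 𝔮))).comap (algebraMap A (Localization.AtPrime 𝔮)) :=
            Ideal.comap_mono hQ.le
        _ = 𝔭 := comap_map_atPrime_of_le 𝔭 𝔮 hle
    · intro heq
      have h := IsLocalization.map_under 𝔮.primeCompl (Localization.AtPrime 𝔮) Q
      rw [Ideal.under_def, heq] at h
      rw [h] at hQ
      exact lt_irrefl _ hQ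

/-- **FINITELY MANY TIE PRIMES OF ORDER `n` OVER A MAXIMAL PRIME OF ORDER `n` (ring level).**  `k₀` perfect, `A` of finite type, `F ∈ A`,
`𝔭` a prime with `ord_{A_𝔭} F = n` such that `ord_{A_𝔮'} F < n` at every prime `𝔮' < 𝔭`.  Then the primes `𝔮 ⊇ 𝔭` at which `(A_𝔮, F/1)` is
a tie position of order `n` are finitely many: each has `(ν ; ε)`-stratum prime `𝔭 A_𝔮` (`topStratumPrime_eq_map_of_maximal`), so `A_𝔭` is
regular of dimension two and the set lies in that of `finite_tiePrimes_over`. [OURS · (c8τ)≤3, ring level]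
[cite: AbramovichQuekSchober2025, Thm 1.3 (3), Thm 3.5] -/
theorem finite_tiePrimes_over_of_maximal (k₀ : Type) [Field k₀] [PerfectField k₀]
    (A : Type) [CommRing A] [Algebra k₀ A] [Algebra.FiniteType k₀ A] (F : A)
    (𝔭 : Ideal A) [𝔭.IsPrime] (n : ℕ)
    (hν𝔭 : iotaOrd (Localization.AtPrime 𝔭) (algebraMap A (Localization.AtPrime 𝔭) F) = n)
    (hmax : ∀ (𝔮' : Ideal A) [𝔮'.IsPrime], 𝔮' < 𝔭 →
      iotaOrd (Localization.AtPrime 𝔮') (algebraMap A (Localization.AtPrime 𝔮') F) < n) :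
    {𝔮 : PrimeSpectrum A | 𝔭 ≤ 𝔮.asIdeal ∧
      IsTiePosition (Localization.AtPrime 𝔮.asIdeal) (algebraMap A (Localization.AtPrime 𝔮.asIdeal) F) ∧
      iotaOrd (Localization.AtPrime 𝔮.asIdeal) (algebraMap A (Localization.AtPrime 𝔮.asIdeal) F) = n}.Finite := by
  classical
  set T := {𝔮 : PrimeSpectrum A | 𝔭 ≤ 𝔮.asIdeal ∧
      IsTiePosition (Localization.AtPrime 𝔮.asIdeal) (algebraMap A (Localization.AtPrime 𝔮.asIdeal) F) ∧
      iotaOrd (Localization.AtPrime 𝔮.asIdeal) (algebraMap A (Localization.AtPrime 𝔮.asIdeal) F) = n} with hT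
  -- the stratum prime of every member is `𝔭 A_𝔮`, and every member lies strictly above `𝔭`
  have htop : ∀ 𝔮 ∈ T, topStratumPrime iotaOrdEps (Localization.AtPrime 𝔮.asIdeal)
      (algebraMap A (Localization.AtPrime 𝔮.asIdeal) F) = 𝔭.map (algebraMap A (Localization.AtPrime 𝔮.asIdeal)) :=
    fun 𝔮 h𝔮 => topStratumPrime_eq_map_of_maximal F 𝔭 n hν𝔭 hmax 𝔮.asIdeal h𝔮.1 h𝔮.2.1 h𝔮.2.2
  have hlt : ∀ 𝔮 ∈ T, 𝔭 < 𝔮.asIdeal := by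
    intro 𝔮 h𝔮
    refine lt_of_le_of_ne h𝔮.1 fun heq => ?_
    have htie := h𝔮.2.1
    haveI := htie.isRegularLocalRing
    obtain ⟨_, hdim, -, -, x, y, z, q, r, lam, hpres⟩ := h𝔮.2.1
    have hP₀ : topStratumPrime iotaOrdEps (Localization.AtPrime 𝔮.asIdeal)
        (algebraMap A (Localization.AtPrime 𝔮.asIdeal) F) = Ideal.span {x, y} := hpres.2.1
    have h1 := htop 𝔮 h𝔮
    rw [hP₀] at h1
    have h2 : 𝔭.map (algebraMap A (Localization.AtPrime 𝔮.asIdeal)) = maximalIdeal (Localization.AtPrime 𝔮.asIdeal) := by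
      rw [heq]; exact Localization.AtPrime.map_eq_maximalIdeal
    exact maximalIdeal_ne_span_pair hdim x y (h2.symm.trans h1.symm)
  rcases T.eq_empty_or_nonempty with hT0 | ⟨𝔮₀, h𝔮₀⟩
  · rw [hT0]; exact Set.finite_empty
  -- `A_𝔭 ≃ (A_𝔮₀)_{𝔭 A_𝔮₀}` is regular of dimension two, `0 ≠ F/1 ∈ 𝔪²_{A_𝔭}`
  have htie₀ := h𝔮₀.2.1
  haveI := htie₀.isRegularLocalRing
  have hlt₀ := hlt 𝔮₀ h𝔮₀
  have htop₀ := htop 𝔮₀ h𝔮₀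
  haveI := isPrime_map_atPrime_of_le 𝔭 𝔮₀.asIdeal hlt₀.le
  haveI := isLocalizationAtPrime_atPrime_map 𝔭 𝔮₀.asIdeal hlt₀.le
  haveI : IsRegularLocalRing (Localization.AtPrime (𝔭.map (algebraMap A (Localization.AtPrime 𝔮₀.asIdeal)))) :=
    isRegularLocalRing_localization_atPrime (Localization.AtPrime 𝔮₀.asIdeal) _
  let e : Localization.AtPrime (𝔭.map (algebraMap A (Localization.AtPrime 𝔮₀.asIdeal))) ≃+* Localization.AtPrime 𝔭 :=
    (IsLocalization.algEquiv 𝔭.primeCompl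
      (Localization.AtPrime (𝔭.map (algebraMap A (Localization.AtPrime 𝔮₀.asIdeal)))) (Localization.AtPrime 𝔭)).toRingEquiv
  haveI hreg𝔭 : IsRegularLocalRing (Localization.AtPrime 𝔭) := IsRegularLocalRing.of_ringEquiv e
  have hdim𝔭 : ringKrullDim (Localization.AtPrime 𝔭) = (2 : ℕ) := by
    haveI : (topStratumPrime iotaOrdEps (Localization.AtPrime 𝔮₀.asIdeal)
        (algebraMap A (Localization.AtPrime 𝔮₀.asIdeal) F)).IsPrime := by rw [htop₀]; infer_instance
    rw [← ringKrullDim_eq_of_ringEquiv e, ← ringKrullDim_atPrime_congr htop₀,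
      IsTiePosition.ringKrullDim_localization_topStratumPrime_eq_two htie₀]
    norm_cast
  obtain ⟨-, -, -, -, n', hn', hν', -, -⟩ := exists_lexMax_datum_of_tiePrime F 𝔭 𝔮₀.asIdeal hlt₀ htie₀ htop₀
  obtain ⟨hFn, hFn1⟩ := (iotaOrd_eq_natCast_iff _ _ _).mp hν'
  have hF0 : algebraMap A (Localization.AtPrime 𝔭) F ≠ 0 := fun h => hFn1 (by rw [h]; exact Ideal.zero_mem _)
  have hF2 : algebraMap A (Localization.AtPrime 𝔭) F ∈ (maximalIdeal (Localization.AtPrime 𝔭)) ^ 2 :=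
    Ideal.pow_le_pow_right hn' hFn
  -- every member lies in the finite set of `finite_tiePrimes_over`
  refine (finite_tiePrimes_over k₀ A F 𝔭 hdim𝔭 hF0 hF2).subset ?_
  intro 𝔮 h𝔮
  have htie := h𝔮.2.1
  obtain ⟨_, hdim, -⟩ := h𝔮.2.1
  exact ⟨hlt 𝔮 h𝔮, le_of_eq hdim, htie, htop 𝔮 h𝔮⟩

/-! ## §2 Scheme level: the tie points of a smooth quasi-compact threefold are finitely many -/

section Scheme

variable {k₀ : Type} [Field k₀] [PerfectField k₀] {Y : Scheme.{0}} (hY : Y ⟶ Spec (CommRingCat.of k₀))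
  [Smooth hY] [QuasiCompact hY]

include hY in
/-- **THE TIE POINTS OF A SMOOTH QUASI-COMPACT THREEFOLD ARE FINITELY MANY.**  `Y` smooth quasi-compact over a perfect field, all local
rings of Krull dimension `≤ 3`, `f ∈ Γ(Y, 𝒪_Y)`: the set `{z | IsTiePosition 𝒪_{Y,z} f_z}` is finite.  Proof: `tiePoints_finite_of_curveFinite'`
with the per-curve binder discharged in an affine chart `U ∋ η` by `finite_tiePrimes_over_of_maximal` for `A = Γ(Y, U)`, `𝔭 = 𝔭_η` (the
maximality of `η` in `{n ≤ ν}` read on the primes `𝔮' < 𝔭_η` through `fromSpec`). [OURS · (c8τ)≤3, scheme level] -/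
theorem tiePoints_finite (hdim3 : ∀ y : Y, ringKrullDim (Y.presheaf.stalk y) ≤ 3) (f : Γ(Y, ⊤)) :
    {z : Y | IsTiePosition (Y.presheaf.stalk z) ((Y.presheaf.germ ⊤ z trivial) f)}.Finite := by
  classical
  refine tiePoints_finite_of_curveFinite' hY hdim3 f ?_
  intro η n hνη hmax _ _
  -- an affine chart through `η`; `A = Γ(Y, U)` is of finite type over `k₀`
  have hηtop : η ∈ (⊤ : Y.Opens) := trivial
  rw [← iSup_affineOpens_eq_top Y] at hηtop
  obtain ⟨U, hη⟩ := Opens.mem_iSup.mp hηtop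
  have hft : RingHom.FiniteType (hY.appLE ⊤ U le_top).hom :=
    HasRingHomProperty.appLE @LocallyOfFiniteType hY inferInstance ⟨⊤, isAffineOpen_top _⟩ U le_top
  let φ : k₀ →+* Γ(Y, U) := (hY.appLE ⊤ U le_top).hom.comp (Scheme.ΓSpecIso (.of k₀)).inv.hom
  have hφ : φ.FiniteType :=
    hft.comp (RingHom.FiniteType.of_surjective _
      (Scheme.ΓSpecIso (.of k₀)).commRingCatIsoToRingEquiv.symm.surjective)
  letI : Algebra k₀ Γ(Y, U) := φ.toAlgebra
  haveI : Algebra.FiniteType k₀ Γ(Y, U) := hφ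
  set F : Γ(Y, U) := Y.presheaf.map (homOfLE le_top).op f with hF
  -- the order at `𝔭 = 𝔭_η` is `n`, and drops strictly below `𝔭`
  have hν𝔭 : iotaOrd (Localization.AtPrime (U.2.primeIdealOf ⟨η, hη⟩).asIdeal)
      (algebraMap Γ(Y, U) (Localization.AtPrime (U.2.primeIdealOf ⟨η, hη⟩).asIdeal) F) = n := by
    rw [← iotaOrd_germ_eq_iotaOrd_localization U f hη]; exact hνη
  have hmax𝔭 : ∀ (𝔮' : Ideal Γ(Y, U)) [𝔮'.IsPrime], 𝔮' < (U.2.primeIdealOf ⟨η, hη⟩).asIdeal →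
      iotaOrd (Localization.AtPrime 𝔮') (algebraMap Γ(Y, U) (Localization.AtPrime 𝔮') F) < n := by
    intro 𝔮' _ hlt
    have hθU : U.2.fromSpec ⟨𝔮', inferInstance⟩ ∈ (U : Y.Opens) := fromSpec_mem U ⟨𝔮', inferInstance⟩
    have hθη : U.2.fromSpec ⟨𝔮', inferInstance⟩ ⤳ η :=
      (GenerizationClosed.le_primeIdealOf_iff_specializes U hη ⟨𝔮', inferInstance⟩).mp hlt.le
    have hne : U.2.fromSpec ⟨𝔮', inferInstance⟩ ≠ η := by
      intro heq
      apply ne_of_lt hlt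
      have h1 := primeIdealOf_fromSpec U ⟨𝔮', inferInstance⟩ hθU
      have h2 : U.2.primeIdealOf ⟨U.2.fromSpec ⟨𝔮', inferInstance⟩, hθU⟩ = U.2.primeIdealOf ⟨η, hη⟩ := by
        congr 1; exact Subtype.ext heq
      rw [h2] at h1
      exact congrArg PrimeSpectrum.asIdeal h1.symm
    have h := hmax _ hθη hne
    rw [iotaOrd_germ_eq_iotaOrd_localization U f hθU] at h
    have h1 := primeIdealOf_fromSpec U ⟨𝔮', inferInstance⟩ hθU
    have key : ∀ (q : PrimeSpectrum Γ(Y, U)), q = ⟨𝔮', inferInstance⟩ →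
        iotaOrd (Localization.AtPrime q.asIdeal) (algebraMap Γ(Y, U) (Localization.AtPrime q.asIdeal) F) < n →
        iotaOrd (Localization.AtPrime 𝔮') (algebraMap Γ(Y, U) (Localization.AtPrime 𝔮') F) < n := by
      rintro q rfl hq; exact hq
    exact key _ h1 h
  -- the fibre over `η` inside `U` is the image of the finite set of tie primes over `𝔭`
  refine ⟨(U : Y.Opens), U.1.isOpen, hη, ?_⟩
  refine ((finite_tiePrimes_over_of_maximal k₀ Γ(Y, U) F (U.2.primeIdealOf ⟨η, hη⟩).asIdeal n hν𝔭 hmax𝔭).image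
    (fun 𝔮 : PrimeSpectrum Γ(Y, U) => (U.2.fromSpec 𝔮 : Y))).subset ?_
  rintro z ⟨⟨hz, hηz, hνz⟩, hzU⟩
  have hzU' : z ∈ (U : Y.Opens) := hzU
  refine ⟨U.2.primeIdealOf ⟨z, hzU'⟩, ⟨?_, ?_, ?_⟩, ?_⟩
  · exact primeIdealOf_le_of_specializes U hzU' hη hηz
  · exact (isTiePosition_germ_iff_localization U f hzU').mp hz
  · rw [← iotaOrd_germ_eq_iotaOrd_localization U f hzU']; exact hνz
  · exact U.2.fromSpec_primeIdealOf ⟨z, hzU'⟩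

end Scheme

end TieFinite

/-! ## §3 The clauses: (c8τ)≤3, (c8)≤3 for the stratifier, and hc8 for `ι₃ᵗ` modulo the cylinder -/

namespace Iota3

/-- **(c8τ)≤3**: the tie bit `τ` satisfies (c8)≤3,p ALONG THE STRATA of `(ν ; ε)` (indeed plainly): on a smooth quasi-compact threefold over a
perfect field the locus `{1 ≤ τ}` = «some generization is a tie» is the finite union of the closures of the tie points
(`GenerizationClosed.indicator_upperSemicontinuousOnLE` on `TieFinite.tiePoints_finite`). [OURS · (c8τ)≤3] -/
theorem iotaTau_upperSemicontinuousOnLE_three (p : ℕ) : IotaUpperSemicontinuousOnLE 3 p iotaOrdEps iotaTau :=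
  GenerizationClosed.indicator_upperSemicontinuousOnLE (fun R _ g => IsTiePosition R g) iotaTau
    (fun S _ g => iotaTau_eq_zero_or_eq_one S g) (fun S _ g => iotaTau_eq_one_iff_exists S g)
    (fun _ _ _ _ e g => (isTiePosition_ringEquiv_iff e g).symm) iotaOrdEps
    (fun _ _ _ _ _ hY _ _ hdim f => TieFinite.tiePoints_finite hY hdim f)

/-- **(c8)≤3 FOR THE STRATIFIER `ι₀ = (ν ; ε ; τ)` — UNCONDITIONAL, every `p`**: `IotaUpperSemicontinuousLE 3 p Iota3.iotaOrdEpsTau`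
(`iotaLex_upperSemicontinuousLE`: `(ν ; ε)` by `iotaOrdEps_upperSemicontinuousLE`, `τ < ω`, and (c8τ)≤3). [OURS · (c8)≤3 for ι₀] -/
theorem iotaOrdEpsTau_upperSemicontinuousLE_three (p : ℕ) : IotaUpperSemicontinuousLE 3 p iotaOrdEpsTau := by
  unfold iotaOrdEpsTau
  exact iotaLex_upperSemicontinuousLE Ordinal.omega0_ne_zero iotaTau_boundedBy_omega0
    (iotaOrdEps_upperSemicontinuousLE 3 p) (iotaTau_upperSemicontinuousOnLE_three p)

/-- **THE GAP hc8 OF THE P3 RUNG REDUCED TO THE CYLINDER CLAUSE**: for the invariant of record `ι₃ᵗ = iotaFlatT`, (c8)≤3,p follows from the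
stratum-relative clause for the generically-read `σ` ALONE, `IotaUpperSemicontinuousOnLE 3 p iotaOrdEpsTau (iotaCylinder iotaOrdEpsTau iotaSigma)`
(the first key `ι₀` is now unconditional). [OURS · hc8 ⟸ (c8-cyl)≤3] -/
theorem iotaFlatT_upperSemicontinuousLE_three_of_cylinder (p : ℕ)
    (hcyl : IotaUpperSemicontinuousOnLE 3 p iotaOrdEpsTau (iotaCylinder iotaOrdEpsTau iotaSigma)) :
    IotaUpperSemicontinuousLE 3 p iotaFlatT := by
  unfold iotaFlatT
  have hΛ : (Ordinal.omega0 + 1) * Ordinal.omega0 ≠ 0 :=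
    mul_ne_zero (fun h => one_ne_zero (Ordinal.add_eq_zero_iff.mp h).2) Ordinal.omega0_ne_zero
  exact iotaLex_upperSemicontinuousLE hΛ (iotaCylinder_boundedBy _ _ iotaSigma_boundedBy)
    (iotaOrdEpsTau_upperSemicontinuousLE_three p) hcyl

end Iota3

end Summit.ResolutionOfSingularities.ResolutionOfSingularities.Cruxes.HypersurfaceCentreConstruction.LocalEngine

end
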